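import Mathlib
import Literature.Analysis.OperatorTheory.ContractiveDetComplexity
import HarnessLib

/-!
# ♦ one-large-class case — piece (a) `piece_a_schurExpansion`: Schur-complement expansion

Crux `PriceOfContractivity` (stmt-ValiantsHypothesis-10583), line `birth`, registered stub
`stub_stableLifting_oneLargeClass`, piece `piece_a_schurExpansion` of the mini-skeleton.

For a block matrix `K = [[A, B], [C, D]]` on `Fin n ⊕ Fin t`, `t ≤ 2`, coloured `x` on the first
block and `c : Fin t → σ` (`c j ≠ x`) on the second, the Sylvester pencil determinant
`det (1 + diag (X ∘ κ) K)` is, POINTWISE at `z` with `a(ξ) := det (1 + ξA) ≠ 0` (`ξ = z_x`),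
`a(ξ) · det (1 + Y M(ξ))` with the Schur complement `M(ξ) = D − ξ C (1 + ξA)⁻¹ B` of size `t`
(`Matrix.det_fromBlocks₁₁`).  Expanding the `t × t` determinant (`t ≤ 2`) and clearing the
denominator with the bordered determinants
`P_w(ξ) = det [[1 + ξA, ξB_w], [C_w, D_ww]] = a(ξ) · det M(ξ)_ww ∈ ℂ[ξ]` (degree `≤ n + |w|`)
gives `â + Ê₁ X_{c₁} + Ê₃ X_{c₂} + Ê₂ X_{c₁} X_{c₂}` (hat = substitution `ξ ↦ X_x`) with
`(c₁, c₂; E₁, E₂, E₃)` = `(x, x; 0, 0, 0)` (`t = 0`), `(c₀, c₀; P_0, 0, 0)` (`t = 1`),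
`(c₀, c₁; P_0, P_{01}, P_1)` (`t = 2`, `c₀ ≠ c₁`), `(c₀, c₀; P_0 + P_1, P_{01}, 0)` (`t = 2`,
`c₀ = c₁`).  The identity of polynomials follows from the pointwise one off the zero set of `a`
on multiplying by `â ≠ 0` in the domain `ℂ[X_σ]`.  All folklore.
-/

noncomputable section

-- `Summit.<Summit>.<Problem>` repeats `ValiantsHypothesis` by the tree's layout convention (D-0017).
set_option linter.dupNamespace false

namespace Summit.ValiantsHypothesis.ValiantsHypothesis.Theorems.PriceOfContractivity.OneLargeClass

open Matrix
open Literature.Analysis.OperatorTheory (eval_det_one_add_diagonal_mul_map_C)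

/-! ### Pointwise Schur complement -/

/-- Block form of a two-block pencil at a point. [folklore] -/
theorem schur_one_add_diagonal_mul_fromBlocks {m o : Type*} [Fintype m] [Fintype o] [DecidableEq m]
    [DecidableEq o] (ξ : ℂ) (y : o → ℂ) (A : Matrix m m ℂ) (B : Matrix m o ℂ) (C : Matrix o m ℂ)
    (D : Matrix o o ℂ) :
    1 + Matrix.diagonal (Sum.elim (fun _ => ξ) y) * Matrix.fromBlocks A B C D =
      Matrix.fromBlocks (1 + ξ • A) (ξ • B) (Matrix.diagonal y * C) (1 + Matrix.diagonal y * D) := by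
  ext (i | i) (j | j) <;> simp [Matrix.diagonal_mul, Matrix.one_apply]

/-- Pointwise Schur complement: `det [[1 + ξA, ξB], [YC, 1 + YD]] = det (1 + ξA) · det (1 + Y M(ξ))`,
`M(ξ) = D − ξ C (1 + ξA)⁻¹ B`, when `det (1 + ξA) ≠ 0`. [folklore] -/
theorem schur_det_blocks_pointwise {m o : Type*} [Fintype m] [Fintype o] [DecidableEq m]
    [DecidableEq o] (ξ : ℂ) (y : o → ℂ) (A : Matrix m m ℂ) (B : Matrix m o ℂ) (C : Matrix o m ℂ)
    (D : Matrix o o ℂ) (hA : (1 + ξ • A).det ≠ 0) :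
    (Matrix.fromBlocks (1 + ξ • A) (ξ • B) (Matrix.diagonal y * C) (1 + Matrix.diagonal y * D)).det =
      (1 + ξ • A).det * (1 + Matrix.diagonal y * (D - ξ • (C * (1 + ξ • A)⁻¹ * B))).det := by
  letI : Invertible (1 + ξ • A) := Matrix.invertibleOfIsUnitDet _ (isUnit_iff_ne_zero.mpr hA)
  rw [Matrix.det_fromBlocks₁₁, Matrix.invOf_eq_nonsing_inv]
  congr 2
  rw [Matrix.mul_sub, Matrix.mul_smul, Matrix.mul_smul, Matrix.mul_assoc, Matrix.mul_assoc,
    Matrix.mul_assoc]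
  abel

/-- The pencil of `[[A, B], [C, D]]` coloured `(x, …, x, c)` evaluated at `z` with
`det (1 + z_x A) ≠ 0`. [folklore] -/
theorem schur_eval_pencil_fromBlocks {σ : Type} {n t : ℕ} (x : σ) (c : Fin t → σ)
    (A : Matrix (Fin n) (Fin n) ℂ) (B : Matrix (Fin n) (Fin t) ℂ) (C : Matrix (Fin t) (Fin n) ℂ)
    (D : Matrix (Fin t) (Fin t) ℂ) (z : σ → ℂ) (hA : (1 + z x • A).det ≠ 0) :
    MvPolynomial.eval z (1 + Matrix.diagonal (fun i => MvPolynomial.X (Sum.elim (fun _ => x) c i)) *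
        (Matrix.fromBlocks A B C D).map (fun a : ℂ => (MvPolynomial.C a : MvPolynomial σ ℂ))).det =
      (1 + z x • A).det *
        (1 + Matrix.diagonal (fun j => z (c j)) * (D - z x • (C * (1 + z x • A)⁻¹ * B))).det := by
  rw [eval_det_one_add_diagonal_mul_map_C]
  have hdiag : (fun i : Fin n ⊕ Fin t => z (Sum.elim (fun _ => x) c i)) =
      Sum.elim (fun _ : Fin n => z x) (fun j => z (c j)) := by
    funext i; rcases i with i | j <;> rfl
  rw [hdiag, schur_one_add_diagonal_mul_fromBlocks, schur_det_blocks_pointwise _ _ _ _ _ _ hA]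

/-! ### The bordered determinant polynomials -/

/-- Evaluating `a = det (1 + ξ • A) ∈ ℂ[ξ]` at a point. [folklore] -/
theorem schur_eval_det_one_add_X_smul {n : ℕ} (A : Matrix (Fin n) (Fin n) ℂ) (ξ : ℂ) :
    ((1 : Matrix (Fin n) (Fin n) (Polynomial ℂ)) +
        (Polynomial.X : Polynomial ℂ) • A.map (fun a : ℂ => Polynomial.C a)).det.eval ξ =
      (1 + ξ • A).det := by
  rw [← Polynomial.coe_evalRingHom, RingHom.map_det]
  congr 1
  ext i j
  rw [RingHom.mapMatrix_apply, Matrix.map_apply, Matrix.add_apply, Matrix.add_apply,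
    Matrix.smul_apply, Matrix.smul_apply, Matrix.map_apply, Matrix.one_apply, Matrix.one_apply]
  split_ifs <;> simp <;> ring

/-! The bordered determinant polynomial is
`P_w(ξ) = det [[1 + ξA, ξB_w], [C_w, D_ww]] ∈ ℂ[ξ]` for `w : Fin s → Fin t` (written out in
full below; no auxiliary definition). -/

/-- `deg P_w ≤ n + |w|` (affine entries). [folklore] -/
theorem natDegree_bordPoly_le {n t s : ℕ} (A : Matrix (Fin n) (Fin n) ℂ) (B : Matrix (Fin n) (Fin t) ℂ)
    (C : Matrix (Fin t) (Fin n) ℂ) (D : Matrix (Fin t) (Fin t) ℂ) (w : Fin s → Fin t) :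
    (Matrix.fromBlocks
        ((1 : Matrix (Fin n) (Fin n) (Polynomial ℂ)) +
          (Polynomial.X : Polynomial ℂ) • A.map (fun a : ℂ => Polynomial.C a))
        ((Polynomial.X : Polynomial ℂ) • (B.submatrix id w).map (fun a : ℂ => Polynomial.C a))
        ((C.submatrix w id).map (fun a : ℂ => Polynomial.C a))
        ((D.submatrix w w).map (fun a : ℂ => Polynomial.C a))).det.natDegree ≤ n + s := by
  have h := Polynomial.natDegree_det_X_add_C_le
    (Matrix.fromBlocks A (B.submatrix id w) 0 0)
    (Matrix.fromBlocks 1 0 (C.submatrix w id) (D.submatrix w w))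
  have hmat : (Polynomial.X : Polynomial ℂ) • (Matrix.fromBlocks A (B.submatrix id w) 0 0).map Polynomial.C +
      (Matrix.fromBlocks 1 0 (C.submatrix w id) (D.submatrix w w)).map Polynomial.C =
      Matrix.fromBlocks
        ((1 : Matrix (Fin n) (Fin n) (Polynomial ℂ)) +
          (Polynomial.X : Polynomial ℂ) • A.map (fun a : ℂ => Polynomial.C a))
        ((Polynomial.X : Polynomial ℂ) • (B.submatrix id w).map (fun a : ℂ => Polynomial.C a))
        ((C.submatrix w id).map (fun a : ℂ => Polynomial.C a))
        ((D.submatrix w w).map (fun a : ℂ => Polynomial.C a)) := by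
    rw [Matrix.fromBlocks_map, Matrix.fromBlocks_map, Matrix.fromBlocks_smul, Matrix.fromBlocks_add]
    simp [Matrix.map_one Polynomial.C (map_zero _) (map_one _), add_comm]
  rw [hmat] at h
  simpa using h

/-- `P_w(ξ) = a(ξ) · det (M(ξ)_ww)` when `a(ξ) = det (1 + ξA) ≠ 0`. [folklore] -/
theorem eval_bordPoly {n t s : ℕ} (A : Matrix (Fin n) (Fin n) ℂ) (B : Matrix (Fin n) (Fin t) ℂ)
    (C : Matrix (Fin t) (Fin n) ℂ) (D : Matrix (Fin t) (Fin t) ℂ) (w : Fin s → Fin t) (ξ : ℂ)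
    (hA : (1 + ξ • A).det ≠ 0) :
    (Matrix.fromBlocks
        ((1 : Matrix (Fin n) (Fin n) (Polynomial ℂ)) +
          (Polynomial.X : Polynomial ℂ) • A.map (fun a : ℂ => Polynomial.C a))
        ((Polynomial.X : Polynomial ℂ) • (B.submatrix id w).map (fun a : ℂ => Polynomial.C a))
        ((C.submatrix w id).map (fun a : ℂ => Polynomial.C a))
        ((D.submatrix w w).map (fun a : ℂ => Polynomial.C a))).det.eval ξ =
      (1 + ξ • A).det * ((D - ξ • (C * (1 + ξ • A)⁻¹ * B)).submatrix w w).det := by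
  have heval : (Matrix.fromBlocks
        ((1 : Matrix (Fin n) (Fin n) (Polynomial ℂ)) +
          (Polynomial.X : Polynomial ℂ) • A.map (fun a : ℂ => Polynomial.C a))
        ((Polynomial.X : Polynomial ℂ) • (B.submatrix id w).map (fun a : ℂ => Polynomial.C a))
        ((C.submatrix w id).map (fun a : ℂ => Polynomial.C a))
        ((D.submatrix w w).map (fun a : ℂ => Polynomial.C a))).det.eval ξ =
      (Matrix.fromBlocks (1 + ξ • A) (ξ • B.submatrix id w) (C.submatrix w id) (D.submatrix w w)).det := by
    rw [← Polynomial.coe_evalRingHom, RingHom.map_det, RingHom.mapMatrix_apply,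
      Matrix.fromBlocks_map]
    congr 1
    ext (i | i) (j | j)
    · rw [Matrix.fromBlocks_apply₁₁, Matrix.fromBlocks_apply₁₁, Matrix.map_apply, Matrix.add_apply,
        Matrix.add_apply, Matrix.smul_apply, Matrix.smul_apply, Matrix.map_apply, Matrix.one_apply,
        Matrix.one_apply]
      split_ifs <;> simp <;> ring
    · rw [Matrix.fromBlocks_apply₁₂, Matrix.fromBlocks_apply₁₂, Matrix.map_apply, Matrix.smul_apply,
        Matrix.smul_apply, Matrix.map_apply, Polynomial.coe_evalRingHom, smul_eq_mul, smul_eq_mul,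
        Polynomial.eval_mul, Polynomial.eval_X, Polynomial.eval_C]
    · rw [Matrix.fromBlocks_apply₂₁, Matrix.fromBlocks_apply₂₁, Matrix.map_apply, Matrix.map_apply,
        Polynomial.coe_evalRingHom, Polynomial.eval_C]
    · rw [Matrix.fromBlocks_apply₂₂, Matrix.fromBlocks_apply₂₂, Matrix.map_apply, Matrix.map_apply,
        Polynomial.coe_evalRingHom, Polynomial.eval_C]
  letI : Invertible (1 + ξ • A) := Matrix.invertibleOfIsUnitDet _ (isUnit_iff_ne_zero.mpr hA)
  rw [heval, Matrix.det_fromBlocks₁₁, Matrix.invOf_eq_nonsing_inv]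
  congr 2
  rw [Matrix.submatrix_sub, Pi.sub_apply, Pi.sub_apply, Matrix.submatrix_smul, Pi.smul_apply,
    Pi.smul_apply, Matrix.submatrix_mul _ _ w id w Function.bijective_id,
    Matrix.submatrix_mul _ _ w id id Function.bijective_id, Matrix.submatrix_id_id, Matrix.mul_smul]

/-! ### From pointwise to polynomial identities -/

/-- Substituting `ξ ↦ X_x` and evaluating. [folklore] -/
theorem schur_eval_aeval_X {σ : Type} (x : σ) (q : Polynomial ℂ) (z : σ → ℂ) :
    MvPolynomial.eval z (Polynomial.aeval (MvPolynomial.X x : MvPolynomial σ ℂ) q) = q.eval (z x) := by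
  rw [Polynomial.aeval_def, Polynomial.eval₂_eq_eval_map, Polynomial.eval_map]
  simp [Polynomial.eval₂_eq_sum_range, Polynomial.eval_eq_sum_range]

/-- Two polynomials over `ℂ` in the variables `σ` that agree at every point off the zero set of
`q(z_x)`, `q(0) ≠ 0`, are equal (multiply the difference by `q̂ ≠ 0` in the domain `ℂ[X_σ]`).
[folklore] -/
theorem schur_eq_of_eval_eq {σ : Type} (x : σ) (q : Polynomial ℂ) (hq : q.eval 0 ≠ 0)
    {L R : MvPolynomial σ ℂ}
    (h : ∀ z : σ → ℂ, q.eval (z x) ≠ 0 → MvPolynomial.eval z L = MvPolynomial.eval z R) : L = R := by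
  have hne : Polynomial.aeval (MvPolynomial.X x : MvPolynomial σ ℂ) q ≠ 0 := by
    intro h0
    apply hq
    have h1 := congrArg (MvPolynomial.eval (0 : σ → ℂ)) h0
    rwa [schur_eval_aeval_X, map_zero] at h1
  refine sub_eq_zero.mp ((mul_eq_zero.mp ?_).resolve_right hne)
  refine MvPolynomial.funext fun z => ?_
  rw [map_mul, map_sub, map_zero, schur_eval_aeval_X]
  by_cases hz : q.eval (z x) = 0
  · rw [hz, mul_zero]
  · rw [h z hz, sub_self, zero_mul]

/-! ### The expansion -/

/-- **Piece (a): Schur-complement expansion of the pencil determinant of a block matrix with at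
most two foreign rows.**  For `K = [[A, B], [C, D]]` (blocks `Fin n`, `Fin t`, `t ≤ 2`) coloured
`x` on the first block and `c` on the second, the pencil determinant equals
`â + Ê₁ X_{c₁} + Ê₃ X_{c₂} + Ê₂ X_{c₁} X_{c₂}` where `a = det (1 + ξA) ∈ ℂ[ξ]`, the `E_v ∈ ℂ[ξ]`
have degree `≤ n + 2`, `^` denotes substitution `ξ ↦ X_x`, and either all `E_v = 0` or
`c₁, c₂ ≠ x` with `E₃ = 0` whenever `c₁ = c₂`. [folklore] -/
theorem piece_a_schurExpansion :
    ∀ {σ : Type} {n t : ℕ} (x : σ) (c : Fin t → σ), t ≤ 2 → (∀ j, c j ≠ x) →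
      ∀ (A : Matrix (Fin n) (Fin n) ℂ) (B : Matrix (Fin n) (Fin t) ℂ) (C : Matrix (Fin t) (Fin n) ℂ)
        (D : Matrix (Fin t) (Fin t) ℂ),
      ∃ (c₁ c₂ : σ) (E₁ E₂ E₃ : Polynomial ℂ),
        E₁.natDegree ≤ n + 2 ∧ E₂.natDegree ≤ n + 2 ∧ E₃.natDegree ≤ n + 2 ∧
        ((c₁ ≠ x ∧ c₂ ≠ x ∧ (c₁ = c₂ → E₃ = 0)) ∨ (E₁ = 0 ∧ E₂ = 0 ∧ E₃ = 0)) ∧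
        (1 + Matrix.diagonal (fun i => MvPolynomial.X (Sum.elim (fun _ => x) c i)) *
            (Matrix.fromBlocks A B C D).map (fun a : ℂ => (MvPolynomial.C a : MvPolynomial σ ℂ))).det =
          Polynomial.aeval (MvPolynomial.X x : MvPolynomial σ ℂ)
              ((1 : Matrix (Fin n) (Fin n) (Polynomial ℂ)) +
                (Polynomial.X : Polynomial ℂ) • A.map (fun a : ℂ => Polynomial.C a)).det +
            Polynomial.aeval (MvPolynomial.X x : MvPolynomial σ ℂ) E₁ * MvPolynomial.X c₁ +
            Polynomial.aeval (MvPolynomial.X x : MvPolynomial σ ℂ) E₃ * MvPolynomial.X c₂ +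
            Polynomial.aeval (MvPolynomial.X x : MvPolynomial σ ℂ) E₂ *
              (MvPolynomial.X c₁ * MvPolynomial.X c₂) := by
  intro σ n t x c ht hc A B C D
  classical
  set a : Polynomial ℂ := ((1 : Matrix (Fin n) (Fin n) (Polynomial ℂ)) +
    (Polynomial.X : Polynomial ℂ) • A.map (fun a : ℂ => Polynomial.C a)).det with ha
  have ha_eval : ∀ ξ : ℂ, a.eval ξ = (1 + ξ • A).det := schur_eval_det_one_add_X_smul A
  have ha0 : a.eval 0 ≠ 0 := by rw [ha_eval]; simp
  -- the bordered determinants `P_w`, packaged by their degree bound and their values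
  have hdef : ∀ {s : ℕ} (w : Fin s → Fin t), s ≤ 2 → ∃ Pw : Polynomial ℂ, Pw.natDegree ≤ n + 2 ∧
      ∀ ξ : ℂ, (1 + ξ • A).det ≠ 0 →
        Pw.eval ξ = (1 + ξ • A).det * ((D - ξ • (C * (1 + ξ • A)⁻¹ * B)).submatrix w w).det :=
    fun w hs => ⟨_, (natDegree_bordPoly_le A B C D w).trans (by omega),
      fun ξ hξ => eval_bordPoly A B C D w ξ hξ⟩
  obtain rfl | rfl | rfl : t = 0 ∨ t = 1 ∨ t = 2 := by omega
  · -- `t = 0`: the single-colour block, `E = 0`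
    refine ⟨x, x, 0, 0, 0, by simp, by simp, by simp, Or.inr ⟨rfl, rfl, rfl⟩, ?_⟩
    refine schur_eq_of_eval_eq x a ha0 fun z hz => ?_
    rw [ha_eval] at hz
    rw [schur_eval_pencil_fromBlocks x c A B C D z hz]
    simp [schur_eval_aeval_X, ha_eval, Matrix.det_fin_zero]
  · -- `t = 1`: one foreign row
    obtain ⟨P0, hP0d, hP0e⟩ := hdef (id : Fin 1 → Fin 1) (by omega)
    refine ⟨c 0, c 0, P0, 0, 0, hP0d, by simp, by simp, Or.inl ⟨hc 0, hc 0, fun _ => rfl⟩, ?_⟩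
    refine schur_eq_of_eval_eq x a ha0 fun z hz => ?_
    rw [ha_eval] at hz
    rw [schur_eval_pencil_fromBlocks x c A B C D z hz]
    simp only [map_add, map_mul, map_zero, zero_mul, add_zero, schur_eval_aeval_X, ha_eval,
      MvPolynomial.eval_X, hP0e (z x) hz, Matrix.submatrix_id_id, Matrix.det_fin_one]
    simp [Matrix.diagonal_mul]
    ring
  · -- `t = 2`: two foreign rows
    by_cases h01 : c 0 = c 1
    · -- same colour: the chain `(c₀) → (c₀ c₀)`
      obtain ⟨P0, hP0d, hP0e⟩ := hdef ![(0 : Fin 2)] (by omega)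
      obtain ⟨P1, hP1d, hP1e⟩ := hdef ![(1 : Fin 2)] (by omega)
      obtain ⟨P01, hP01d, hP01e⟩ := hdef (id : Fin 2 → Fin 2) (by omega)
      refine ⟨c 0, c 0, P0 + P1, P01, 0, ?_, hP01d, by simp, Or.inl ⟨hc 0, hc 0, fun _ => rfl⟩, ?_⟩
      · exact (Polynomial.natDegree_add_le _ _).trans (max_le hP0d hP1d)
      refine schur_eq_of_eval_eq x a ha0 fun z hz => ?_
      rw [ha_eval] at hz
      rw [schur_eval_pencil_fromBlocks x c A B C D z hz]
      simp only [map_add, map_mul, map_zero, zero_mul, add_zero, schur_eval_aeval_X, ha_eval,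
        MvPolynomial.eval_X, hP0e (z x) hz, hP1e (z x) hz, hP01e (z x) hz,
        Matrix.submatrix_id_id, Matrix.det_fin_one, Matrix.det_fin_two]
      simp [Matrix.diagonal_mul, Matrix.submatrix_apply, ← h01]
      ring
    · -- two distinct colours: the trie `(c₀), (c₀ c₁), (c₁)`
      obtain ⟨P0, hP0d, hP0e⟩ := hdef ![(0 : Fin 2)] (by omega)
      obtain ⟨P1, hP1d, hP1e⟩ := hdef ![(1 : Fin 2)] (by omega)
      obtain ⟨P01, hP01d, hP01e⟩ := hdef (id : Fin 2 → Fin 2) (by omega)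
      refine ⟨c 0, c 1, P0, P01, P1, hP0d, hP01d, hP1d, Or.inl ⟨hc 0, hc 1, fun h => absurd h h01⟩, ?_⟩
      refine schur_eq_of_eval_eq x a ha0 fun z hz => ?_
      rw [ha_eval] at hz
      rw [schur_eval_pencil_fromBlocks x c A B C D z hz]
      simp only [map_add, map_mul, schur_eval_aeval_X, ha_eval,
        MvPolynomial.eval_X, hP0e (z x) hz, hP1e (z x) hz, hP01e (z x) hz,
        Matrix.submatrix_id_id, Matrix.det_fin_one, Matrix.det_fin_two]
      simp [Matrix.diagonal_mul, Matrix.submatrix_apply]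
      ring

end Summit.ValiantsHypothesis.ValiantsHypothesis.Theorems.PriceOfContractivity.OneLargeClass
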